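import Mathlib
import Summits.CriticalPhenomena.PercolationContinuityZ3.Theorems.PercNearOneGluingNoHeavyLowerTailSahiCombFiveUpSet

/-!
# The five-up-set inequality, RANK route I: zeta functions on an up-set, the support lemma, and the antipodal basis

Support file of the one-cut programme (crux `NoHeavyLowerTail`, stmt-CriticalPhenomena-4575; lemma factory `prim-lf-1`, gen 16–18;
memos `FROM-prim-lf-1-gen16-FIVE-UPSET-RANK.md`, `FROM-prim-lf-1-gen17-FIVE-UPSET-PROOF.md`).  Self-contained linear algebra over `ℚ`
on the Boolean lattice `Finset α` with the antipode `s ↦ sᶜ` (`FiveUpSet.refl`).  For `d : Finset α` the ZETA FUNCTION of `d` is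
`t ↦ [d ⊆ t]`, written here as the `ℚ`-valued `if d ⊆ t then 1 else 0`; for a family `W` we look at its restriction to `W`,
a vector of `ℚ^W = (↥W → ℚ)`.

* `sum_powerset_neg_one_pow_card_zeta` — `Σ_{e ⊆ d} (-1)^{#e} [e ⊆ t] = [d ∩ t = ∅]` (the `+1/−1` trick);
* `inter_ne_empty_of_compl_not_mem` — if `W` is an up-set, `dᶜ ∉ W` and `t ∈ W` then `d ∩ t ≠ ∅`;
* **`exists_support_coef`** (SUPPORT LEMMA) — for an up-set `W` and any `d`, on `W` the zeta function of `d` is a `ℚ`-combination of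
  zeta functions of sets `e ⊆ d` with `eᶜ ∈ W` (the trivial combination when `dᶜ ∈ W`); proof: strong induction on `d`, peeling the
  top term off `Σ_{e ⊆ d} (-1)^{#e}[e ⊆ t] = [d ∩ t = ∅] = 0` (`t ∈ W`, `dᶜ ∉ W`);
* `indicator_mem_span_zeta` — every coordinate vector of `ℚ^W` is a combination of restricted zeta functions (downward induction);
* **`linearIndependent_zeta_refl`** (C1, the ANTIPODAL BASIS) — for an up-set `W` the restricted zeta functions of the `e` with
  `eᶜ ∈ W` are linearly independent in `ℚ^W` (they span by the two previous lemmas and `#(refl W) = #W`); Kleitman's antipodal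
  bijection `refl W ↪ W`, `e ↦ t ⊇ e`, is a non-zero maximal minor of this square matrix;
* **`eq_zero_of_zeta_sum_eq_zero`** — C1 in coefficient form: `g` supported on `refl W` and `Σ_e g e [e ⊆ t] = 0` for all `t ∈ W`
  force `g = 0`.  This is the only form used downstream (`…SahiCombFiveUpSetProof`).
HONEST LABEL: elementary lemmas (all proved, std axioms); the five-up-set inequality itself is proved in the companion file. [this work]
-/

namespace Summit.CriticalPhenomena.PercolationContinuityZ3.Theorems

namespace FiveUpSet

open Finset

variable {α : Type*} [DecidableEq α] [Fintype α]

/-! ### Alternating sums of zeta functions -/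

omit [Fintype α] in
/-- `Σ_{e ⊆ s} (-1)^{#e} = [s = ∅]` over `ℚ` (Mathlib's `Finset.sum_powerset_neg_one_pow_card`, cast). [folklore] -/
theorem sum_powerset_neg_one_pow_card_rat (s : Finset α) :
    ∑ e ∈ s.powerset, (-1 : ℚ) ^ e.card = if s = ∅ then 1 else 0 := by
  have h := Finset.sum_powerset_neg_one_pow_card (x := s)
  have h' := congrArg (fun z : ℤ => (z : ℚ)) h
  simp only [Int.cast_sum, Int.cast_pow, Int.cast_neg, Int.cast_one] at h'
  rw [h']
  split_ifs <;> simp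

omit [Fintype α] in
/-- The `+1/−1` trick for zeta functions: `Σ_{e ⊆ d} (-1)^{#e} [e ⊆ t] = [d ∩ t = ∅]`. [folklore] -/
theorem sum_powerset_neg_one_pow_card_zeta (d t : Finset α) :
    ∑ e ∈ d.powerset, (-1 : ℚ) ^ e.card * (if e ⊆ t then (1 : ℚ) else 0) = if d ∩ t = ∅ then 1 else 0 := by
  rw [← sum_powerset_neg_one_pow_card_rat (d ∩ t)]
  have hf : (d ∩ t).powerset = d.powerset.filter (fun e => e ⊆ t) := by
    ext e
    simp only [mem_powerset, mem_filter, subset_inter_iff]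
  rw [hf, Finset.sum_filter]
  refine sum_congr rfl fun e _ => ?_
  split_ifs <;> simp

/-- If `W` is an up-set of the cube, `dᶜ ∉ W` and `t ∈ W`, then `d` meets `t`. [this work] -/
theorem inter_ne_empty_of_compl_not_mem {W : Finset (Finset α)} (hW : IsUpperSet (W : Set (Finset α)))
    {d t : Finset α} (hd : dᶜ ∉ W) (ht : t ∈ W) : d ∩ t ≠ ∅ := by
  intro h
  apply hd
  have hsub : t ⊆ dᶜ := by
    intro x hx
    rw [mem_compl]
    intro hxd
    have hx' : x ∈ d ∩ t := mem_inter.2 ⟨hxd, hx⟩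
    rw [h] at hx'
    simp at hx'
  exact hW hsub ht

/-! ### The support lemma -/

/-- **SUPPORT LEMMA** (coefficient form).  For an up-set `W` and any `d` there are coefficients `c e`, non-zero only for `e ⊆ d`
with `eᶜ ∈ W`, such that `[d ⊆ t] = Σ_e c e · [e ⊆ t]` for every `t ∈ W`; when `dᶜ ∈ W` one may (and we do) take `c = δ_d`.
Proof: strong induction on `d`; if `dᶜ ∉ W` then every `t ∈ W` meets `d`, so `Σ_{e ⊆ d} (-1)^{#e} [e ⊆ t] = 0` expresses
`[d ⊆ t]` on `W` through the proper subsets of `d`. [this work] -/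
theorem exists_support_coef {W : Finset (Finset α)} (hW : IsUpperSet (W : Set (Finset α))) (d : Finset α) :
    ∃ c : Finset α → ℚ, (dᶜ ∈ W → c = fun e => if e = d then 1 else 0) ∧ (∀ e, c e ≠ 0 → eᶜ ∈ W ∧ e ⊆ d) ∧
      ∀ t ∈ W, (if d ⊆ t then (1 : ℚ) else 0) = ∑ e, c e * (if e ⊆ t then (1 : ℚ) else 0) := by
  induction d using Finset.strongInduction with
  | H d ih =>
    by_cases hd : dᶜ ∈ W
    · refine ⟨fun e => if e = d then 1 else 0, fun _ => rfl, ?_, ?_⟩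
      · intro e he
        by_cases hed : e = d
        · subst hed
          exact ⟨hd, Finset.Subset.refl _⟩
        · simp [hed] at he
      · intro t _
        simp only [ite_mul, one_mul, zero_mul, Finset.sum_ite_eq', Finset.mem_univ, if_true]
    · have ih' : ∀ e, e ⊂ d → ∃ c : Finset α → ℚ, (∀ x, c x ≠ 0 → xᶜ ∈ W ∧ x ⊆ e) ∧
          ∀ t ∈ W, (if e ⊆ t then (1 : ℚ) else 0) = ∑ x, c x * (if x ⊆ t then (1 : ℚ) else 0) := by
        intro e he
        obtain ⟨c, -, hc1, hc2⟩ := ih e he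
        exact ⟨c, hc1, hc2⟩
      choose! c hc using ih'
      have hmem : ∀ e, e ∈ d.powerset.erase d → e ⊂ d := by
        intro e he
        rw [mem_erase, mem_powerset] at he
        exact Finset.ssubset_iff_subset_ne.2 ⟨he.2, he.1⟩
      refine ⟨fun x => ∑ e ∈ d.powerset.erase d, (-((-1 : ℚ) ^ d.card * (-1 : ℚ) ^ e.card)) * c e x,
        fun h => absurd h hd, ?_, ?_⟩
      · intro x hx
        obtain ⟨e, he, hne⟩ := Finset.exists_ne_zero_of_sum_ne_zero hx
        have hed : e ⊂ d := hmem e he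
        have hcx : c e x ≠ 0 := right_ne_zero_of_mul hne
        obtain ⟨hxW, hxe⟩ := (hc e hed).1 x hcx
        exact ⟨hxW, hxe.trans hed.subset⟩
      · intro t ht
        have hz := sum_powerset_neg_one_pow_card_zeta d t
        rw [if_neg (inter_ne_empty_of_compl_not_mem hW hd ht)] at hz
        rw [← Finset.add_sum_erase _ _ (mem_powerset_self d)] at hz
        have hsq : (-1 : ℚ) ^ d.card * (-1 : ℚ) ^ d.card = 1 := by
          rw [← mul_pow]
          norm_num
        have step1 : (if d ⊆ t then (1 : ℚ) else 0)
            = ∑ e ∈ d.powerset.erase d, (-((-1 : ℚ) ^ d.card * (-1 : ℚ) ^ e.card)) * (if e ⊆ t then (1 : ℚ) else 0) := by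
          calc (if d ⊆ t then (1 : ℚ) else 0)
              = ((-1 : ℚ) ^ d.card * (-1 : ℚ) ^ d.card) * (if d ⊆ t then (1 : ℚ) else 0) := by rw [hsq, one_mul]
            _ = (-1 : ℚ) ^ d.card * (-(∑ e ∈ d.powerset.erase d, (-1 : ℚ) ^ e.card * (if e ⊆ t then (1 : ℚ) else 0))) := by
                rw [mul_assoc, eq_neg_of_add_eq_zero_left hz]
            _ = ∑ e ∈ d.powerset.erase d, (-((-1 : ℚ) ^ d.card * (-1 : ℚ) ^ e.card)) * (if e ⊆ t then (1 : ℚ) else 0) := by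
                rw [mul_neg, Finset.mul_sum, ← Finset.sum_neg_distrib]
                refine sum_congr rfl fun e _ => ?_
                ring
        rw [step1]
        have step2 : ∀ e ∈ d.powerset.erase d,
            (-((-1 : ℚ) ^ d.card * (-1 : ℚ) ^ e.card)) * (if e ⊆ t then (1 : ℚ) else 0)
              = ∑ x, (-((-1 : ℚ) ^ d.card * (-1 : ℚ) ^ e.card)) * c e x * (if x ⊆ t then (1 : ℚ) else 0) := by
          intro e he
          rw [(hc e (hmem e he)).2 t ht, Finset.mul_sum]
          refine sum_congr rfl fun x _ => ?_
          ring
        rw [sum_congr rfl step2, Finset.sum_comm]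
        refine sum_congr rfl fun x _ => ?_
        rw [Finset.sum_mul]

/-! ### The antipodal basis of `ℚ^W` -/

/-- Every coordinate vector of `ℚ^W` (the indicator of one `t₀`) is a `ℚ`-combination of restricted zeta functions `t ↦ [d ⊆ t]`:
`𝟙_{t₀} = ζ_{t₀}|_W − Σ_{t ∈ W, t ⊋ t₀} 𝟙_t`, by downward induction. [folklore] -/
theorem indicator_mem_span_zeta (W : Finset (Finset α)) (t₀ : Finset α) :
    (fun u : ↥W => if (u : Finset α) = t₀ then (1 : ℚ) else 0) ∈
      Submodule.span ℚ (Set.range fun d : Finset α => fun u : ↥W => if d ⊆ (u : Finset α) then (1 : ℚ) else 0) := by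
  suffices h : ∀ s : Finset α, (fun u : ↥W => if (u : Finset α) = sᶜ then (1 : ℚ) else 0) ∈
      Submodule.span ℚ (Set.range fun d : Finset α => fun u : ↥W => if d ⊆ (u : Finset α) then (1 : ℚ) else 0) by
    have h' := h t₀ᶜ
    simpa only [compl_compl] using h'
  intro s
  induction s using Finset.strongInduction with
  | H s ih =>
    have key : (fun u : ↥W => if (u : Finset α) = sᶜ then (1 : ℚ) else 0)
        = (fun u : ↥W => if sᶜ ⊆ (u : Finset α) then (1 : ℚ) else 0)
          - ∑ t ∈ W.filter (fun t => sᶜ ⊂ t), (fun u : ↥W => if (u : Finset α) = t then (1 : ℚ) else 0) := by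
      funext u
      simp only [Pi.sub_apply, Finset.sum_apply]
      rw [Finset.sum_ite_eq]
      simp only [mem_filter, Finset.coe_mem, true_and]
      by_cases h1 : sᶜ ⊆ (u : Finset α)
      · by_cases h2 : (u : Finset α) = sᶜ
        · simp [h2]
        · have h3 : sᶜ ⊂ (u : Finset α) := Finset.ssubset_iff_subset_ne.2 ⟨h1, Ne.symm h2⟩
          simp [h1, h2, h3]
      · have h2 : ¬ (u : Finset α) = sᶜ := fun h => h1 (h ▸ Finset.Subset.refl _)
        have h3 : ¬ sᶜ ⊂ (u : Finset α) := fun h => h1 h.subset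
        simp [h1, h2, h3]
    rw [key]
    refine Submodule.sub_mem _ (Submodule.subset_span ⟨sᶜ, rfl⟩) (Submodule.sum_mem _ fun t ht => ?_)
    have hts : tᶜ ⊂ s := by
      have h := (mem_filter.1 ht).2
      have h' : tᶜ ⊂ sᶜᶜ := Finset.compl_ssubset_compl.2 h
      rwa [compl_compl] at h'
    have h := ih tᶜ hts
    simpa only [compl_compl] using h

/-- **C1 — THE ANTIPODAL BASIS.**  For an up-set `W` of the cube, the restricted zeta functions `t ↦ [e ⊆ t]` (`t ∈ W`), indexed
by `e ∈ refl W` (i.e. `eᶜ ∈ W`), are linearly independent in `ℚ^W` — hence a basis, as `#(refl W) = #W`.  Proof: they span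
(`indicator_mem_span_zeta` + the support lemma) and their number is the dimension.  Kleitman's antipodal lemma
`#(U ∩ refl X) ≤ #(U ∩ X)` is the statement that a maximal minor of this matrix is non-zero. [this work] -/
theorem linearIndependent_zeta_refl {W : Finset (Finset α)} (hW : IsUpperSet (W : Set (Finset α))) :
    LinearIndependent ℚ (fun e : ↥(refl W) => fun u : ↥W => if (e : Finset α) ⊆ (u : Finset α) then (1 : ℚ) else 0) := by
  apply linearIndependent_of_top_le_span_of_card_eq_finrank
  · rintro f -
    rw [pi_eq_sum_univ f]
    refine Submodule.sum_mem _ fun u _ => Submodule.smul_mem _ _ ?_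
    have h1 : (fun j : ↥W => if u = j then (1 : ℚ) else 0)
        = (fun j : ↥W => if (j : Finset α) = (u : Finset α) then (1 : ℚ) else 0) := by
      funext j
      by_cases h : u = j
      · subst h; simp
      · have h' : ¬ (j : Finset α) = (u : Finset α) := fun h'' => h (Subtype.ext h''.symm)
        simp [h, h']
    rw [h1]
    refine (Submodule.span_le.mpr ?_) (indicator_mem_span_zeta W (u : Finset α))
    rintro _ ⟨d, rfl⟩
    obtain ⟨c, -, hc, hct⟩ := exists_support_coef hW d
    have hsum : (fun u : ↥W => if d ⊆ (u : Finset α) then (1 : ℚ) else 0)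
        = ∑ e ∈ refl W, c e • (fun u : ↥W => if e ⊆ (u : Finset α) then (1 : ℚ) else 0) := by
      funext u
      rw [hct u u.2, Finset.sum_apply]
      simp only [Pi.smul_apply, smul_eq_mul]
      refine (Finset.sum_subset (subset_univ _) ?_).symm
      intro e _ he
      have h0 : c e = 0 := by
        by_contra hne
        exact he (mem_refl.2 (hc e hne).1)
      rw [h0, zero_mul]
    change (fun u : ↥W => if d ⊆ (u : Finset α) then (1 : ℚ) else 0) ∈ _
    rw [hsum]
    exact Submodule.sum_mem _ fun e he => Submodule.smul_mem _ _ (Submodule.subset_span ⟨⟨e, he⟩, rfl⟩)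
  · rw [Fintype.card_coe, card_refl, Module.finrank_fintype_fun_eq_card, Fintype.card_coe]

/-- **C1 in coefficient form.**  If `W` is an up-set, `g` vanishes off `refl W` (i.e. `g e ≠ 0 → eᶜ ∈ W`) and
`Σ_e g e · [e ⊆ t] = 0` for every `t ∈ W`, then `g = 0`. [this work] -/
theorem eq_zero_of_zeta_sum_eq_zero {W : Finset (Finset α)} (hW : IsUpperSet (W : Set (Finset α)))
    (g : Finset α → ℚ) (hg : ∀ e, g e ≠ 0 → eᶜ ∈ W)
    (h : ∀ t ∈ W, ∑ e, g e * (if e ⊆ t then (1 : ℚ) else 0) = 0) : ∀ e, g e = 0 := by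
  have hli := linearIndependent_zeta_refl hW
  have hrel : ∑ e : ↥(refl W), g e • (fun u : ↥W => if (e : Finset α) ⊆ (u : Finset α) then (1 : ℚ) else 0) = 0 := by
    funext u
    rw [Finset.sum_apply]
    simp only [Pi.smul_apply, smul_eq_mul, Pi.zero_apply]
    rw [Finset.sum_coe_sort (refl W) (fun e => g e * (if e ⊆ (u : Finset α) then (1 : ℚ) else 0))]
    rw [Finset.sum_subset (subset_univ _) ?_]
    · exact h u u.2
    · intro e _ he
      have h0 : g e = 0 := by
        by_contra hne
        exact he (mem_refl.2 (hg e hne))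
      rw [h0, zero_mul]
  have hzero := Fintype.linearIndependent_iff.1 hli (fun e => g e) hrel
  intro e
  by_contra hne
  exact hne (hzero ⟨e, mem_refl.2 (hg e hne)⟩)

end FiveUpSet

end Summit.CriticalPhenomena.PercolationContinuityZ3.Theorems
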